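import Literature.MathematicalPhysics.QuantumFieldTheory.Balaban1983to89.Node00.IndexMapCollarRadius
import Literature.MathematicalPhysics.QuantumFieldTheory.Balaban1983to89.Node00.DressedSlotsOfRecord12

/-!
# NODE 00 — THE COLLAR RADIUS OF def-T's INDEX MAP IN THE TORUS METRIC: coordinate cyclic distances (`coordDist`) — symmetry, triangle inequality, «hull ⇒ near»
# (the converse of dag-n12-e's `mem_hullD_of_near`), CROSS-SCALE conversion of layer hulls — and the one-step collar radius as a distance bound:
# every point of `Z_{k+1}(t)` is coordinatewise within `25·sideD k` of `Z_k` or of a label cube of `t`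

Seat `pub-ymgap-dag-n20-d` (R134 (a) N20 NE7b s3), gen 38; `--kind proof --supports stmt-QuantumFields-27366`; COUNT-NEUTRAL; THEOREMS ONLY.  [III] = [Balaban1988Convergent].
Companion of `Node00.IndexMapCollarRadius` (gen 38, p766498: `compl_Λ_succ_σOfRecord_subset_hullD` — the hull form, radius 24 layers of `𝐃_{k+1}`-cubes),
`B15Claim189LambdaPin` §1 (dag-n12-e: `coordDist`, `coordDist_eq_natAbs`, `exists_lift_near`, `mem_hullD_of_near`) and `B14SeparationOfRecord` §1 (dag-n11-e: `mem_hullD_iff`).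

WHY.  The hull form of the collar radius lives on ONE cube family (`sideD k`); iterating it down a history needs the conversion between the cube families of consecutive levels
(`sideD (k−1) ≤ sideD k`, in print `= L·R_{k+1}∕R_k ≥ 2`-fold), which is a statement about DISTANCES: `hullD_s n X ⊆ {y : ∃ c ∈ X, ∀ i, coordDist c y i + 1 ≤ (n+1)·s} ⊆ hullD_{s′} n′ X`
whenever `(n+1)·s ≤ n′·s′ + 1` (§1).  §2 restates the one-step collar radius in this currency — the form in which the scale gain of [LF-II] (1.80)–(1.81) p. 384–385 («the square
root appears here, because for some steps we do not gain the scaling factor L⁻¹») can be booked by a consumer summing the per-level radii `25·sideD j`.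

WHAT IS HERE.  §1 (generic `P`, `s`; the `coordDist` symmetry ∕ triangle ∕ cover lemmas are PRIVATE twins of dag-n20-c's Summits-side `…N20LCSHullSeparation` §1, which a
Literature module cannot import — a librarian may re-home that §1 here): `exists_near_of_mem_hullD` (hull ⇒ near), ★ `hullD_subset_hullD_of_scale`
(cross-scale: `hullD_s n X ⊆ hullD_{s′} n′ X` for `(n+1)·s ≤ n′·s′ + 1`, `0 < s′`); §2 ★★ `exists_near_of_mem_compl_Λ_succ_σOfRecord` (every point of `((σ s t).Λ (k+1))ᶜ` has a point
of `Z_k ∪ ∪P ∪ ∪Q ∪ ∪R` coordinatewise within `25·sideD k − 1`), `exists_near_label_of_mem_compl_Λ_succ_σOfRecord_of_far` (if moreover every point of `Z_k` is farther than that in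
some coordinate, the near point lies in a label cube); §3 ★★★ `exists_label_near_of_mem_Zreg_of_present` (down a PRESENT history — every level produced by the index map from the one
below — every point of `Z_k` is within `Σ_{l∈[j,k)} 25·sideD l` of a label cube of some level `j < k`: induction with the triangle inequality); §4 presence: in F3's
start-generic tower (any start, any selector) `texpAOfRecordFrom_succ_eq_zero_of_init_eq_zero ∕ _of_forall_σ_ne`, ★★ `present_of_texpAOfRecordFrom_ne_zero` (a non-zero slot at
level `k` ⇒ every level produced by the index map), `present_of_dressedSlotsOfDatum₉_ne_zero`, ★★★ `exists_label_near_of_mem_Zreg_of_dressedSlotsOfDatum₉_ne_zero` (the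
geometric letter: a non-zero dressed slot's large-field points are generated, within the summed radius, by label cubes of its own history).

HONEST SCOPE.  [bookkeeping] finite torus geometry (`ZMod.valMinAbs` arithmetic) over def-T's definitions BY NAME; nothing of Bałaban's asserted; no estimate; counts UNMOVED
(typed 28∕28 · discharged 8∕27); one finite four-torus programme at fixed `ε` — nothing continuum ∕ ℝ⁴ ∕ OS ∕ mass gap ∕ Clay.  No `def`, no `sorry`, no `axiom`, no `instance`, no `notation`.
-/

noncomputable section

namespace Literature.MathematicalPhysics.QuantumFieldTheory.Balaban1983to89.Node00

open T4Continuum B14.Eq218Concrete B14DomainGeom B14.Eq213MaximalDomains B15Eq112TorusCover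
open B14SeparationOfRecord (mem_hullD_iff)
open B15Claim189LambdaPin (coordDist coordDist_eq_natAbs mem_hullD_of_near hullD_mono_layers)

/-! ## §1  The torus metric: symmetry, triangle inequality, hull ⇒ near, cross-scale hulls -/

section Metric

variable {P : Params} {s : ℕ}

/-- `coordDist` is symmetric (private twin of dag-n20-c's Summits-side `…N20LCSHullSeparation.coordDist_comm`, which a Literature file cannot import). [folklore] -/
private theorem coordDist_comm (x y : Site P 0) (i : Fin P.d) : coordDist x y i = coordDist y x i := by
  unfold coordDist
  exact min_comm _ _

/-- The balanced residue of a sum is no longer than the sum of the balanced residues. [folklore] -/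
private theorem natAbs_valMinAbs_add_le {n : ℕ} [NeZero n] (a b : ZMod n) :
    (a + b).valMinAbs.natAbs ≤ a.valMinAbs.natAbs + b.valMinAbs.natAbs := by
  have h := ZMod.natAbs_min_of_le_div_two n ((a + b).valMinAbs) (a.valMinAbs + b.valMinAbs)
    (by simp only [Int.cast_add, ZMod.coe_valMinAbs]) (ZMod.natAbs_valMinAbs_le _)
  exact h.trans (Int.natAbs_add_le _ _)

/-- Triangle inequality for the coordinate cyclic distance (private twin of dag-n20-c's Summits-side `coordDist_triangle`). [folklore] -/
private theorem coordDist_triangle (x y z : Site P 0) (i : Fin P.d) : coordDist x z i ≤ coordDist x y i + coordDist y z i := by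
  rw [coordDist_eq_natAbs, coordDist_eq_natAbs, coordDist_eq_natAbs, show x i - z i = (x i - y i) + (y i - z i) by ring]
  exact natAbs_valMinAbs_add_le _ _

/-- The cyclic distance of two covered points is at most the distance of the representatives (private twin of dag-n20-c's Summits-side
`coordDist_cover_le_natAbs`). [folklore] -/
private theorem coordDist_cover_le_natAbs (z₁ z₂ : Pt P.d) (i : Fin P.d) : coordDist (cover P z₁) (cover P z₂) i ≤ (z₁ i - z₂ i).natAbs := by
  rw [coordDist_eq_natAbs]
  refine ZMod.natAbs_min_of_le_div_two (P.sitesPerDir 0) _ _ ?_ (ZMod.natAbs_valMinAbs_le _)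
  rw [ZMod.coe_valMinAbs, cover_apply, cover_apply]
  push_cast
  ring

/-- A point of `□^{∼n}` and a point of `□` are coordinatewise within `(n+1)·s − 1` (private; dag-n20-c's Summits-side `coordDist_lt_of_mem_cubeEnl` is the two-collar
form). [folklore] -/
private theorem coordDist_succ_le_of_mem_cubeEnl {a : Pt P.d} {n : ℕ} {y c : Site P 0} (hy : y ∈ cubeEnl P s a n) (hc : c ∈ cubeEnl P s a 0) (i : Fin P.d) :
    coordDist c y i + 1 ≤ (n + 1) * s := by
  obtain ⟨z₁, hz₁, rfl⟩ := hy
  obtain ⟨z₂, hz₂, rfl⟩ := hc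
  have h := coordDist_cover_le_natAbs (P := P) z₂ z₁ i
  have h1 := hz₁ i
  have h2 := hz₂ i
  simp only [Nat.zero_mul, Nat.cast_zero, sub_zero, add_zero] at h2
  have hcast : (((n + 1) * s : ℕ) : ℤ) = ((n * s : ℕ) : ℤ) + (s : ℤ) := by push_cast; ring
  have hb : ((z₂ i - z₁ i).natAbs : ℤ) + 1 ≤ (((n + 1) * s : ℕ) : ℤ) := by
    rw [hcast, Int.natCast_natAbs]
    rcases le_total 0 (z₂ i - z₁ i) with h0 | h0
    · rw [abs_of_nonneg h0]; linarith [h1.1, h2.2]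
    · rw [abs_of_nonpos h0]; linarith [h1.2, h2.1]
  have : (coordDist (cover P z₂) (cover P z₁) i : ℤ) + 1 ≤ (((n + 1) * s : ℕ) : ℤ) := by
    have h' : (coordDist (cover P z₂) (cover P z₁) i : ℤ) ≤ ((z₂ i - z₁ i).natAbs : ℤ) := by exact_mod_cast h
    linarith
  exact_mod_cast this

/-- **HULL ⇒ NEAR** (the converse of `mem_hullD_of_near`): a point of `hullD s n X` has a point of `X` coordinatewise within `(n+1)·s − 1`.
[cite: Balaban1988Convergent, p.264–265 («the union of all … cubes intersecting», «surrounded by n layers»; bookkeeping)] -/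
theorem exists_near_of_mem_hullD {n : ℕ} {X : Set (Site P 0)} {y : Site P 0} (hy : y ∈ hullD P s n X) :
    ∃ c ∈ X, ∀ i, coordDist c y i + 1 ≤ (n + 1) * s := by
  obtain ⟨a, -, ⟨z, hza, hzX⟩, hya⟩ := mem_hullD_iff.1 hy
  refine ⟨z, hzX, fun i => ?_⟩
  rw [coordDist_comm]
  exact coordDist_succ_le_of_mem_cubeEnl hza hya i

/-- ★ **CROSS-SCALE CONVERSION OF LAYER HULLS**: `hullD_s n X ⊆ hullD_{s′} n′ X` whenever `(n+1)·s ≤ n′·s′ + 1` and `0 < s′` — e.g. `n′ = n + 1` for `s ≤ s′` (coarser cubes one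
level up), or `n′ = ⌈(n+1)∕2⌉` for `2s ≤ s′` (the scale gain). [cite: Balaban1988Convergent, p.264–265 (bookkeeping); Balaban1989LargeFieldII, (1.80)–(1.81) p.384–385 (the scale gain)] -/
theorem hullD_subset_hullD_of_scale {s' n n' : ℕ} (hs' : 0 < s') (h : (n + 1) * s ≤ n' * s' + 1) (X : Set (Site P 0)) :
    hullD P s n X ⊆ hullD P s' n' X := by
  intro y hy
  obtain ⟨c, hcX, hc⟩ := exists_near_of_mem_hullD hy
  exact mem_hullD_of_near hs' hcX fun i => by have := hc i; omega

end Metric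

/-! ## §2  The one-step collar radius as a distance bound -/

section IndexMap

variable {F : T4Family} {ν : Stage7Numerics} {M : ℕ} {p : B12.RunParams} {g : ℕ → ℝ} {k : ℕ}

/-- ★★ **THE COLLAR RADIUS IN THE TORUS METRIC**: every point `x` of the new large-field region `((σ s t).Λ (k+1))ᶜ` has a point `c` of `Z_k ∪ ∪P ∪ ∪Q ∪ ∪R` with
`coordDist c x i + 1 ≤ 25·sideD k` in every coordinate (`0 < sideD k`). [cite: Balaban1988Convergent, (3.5) p.265, (3.20) p.269 (bookkeeping)] -/
theorem exists_near_of_mem_compl_Λ_succ_σOfRecord (hsD : 0 < sideD F ν M p g k) (s : SeqOfRecord F ν M g p.K k) (t : LbOfRecord F ν p g k)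
    {x : Site (F.P p.K) 0} (hx : x ∈ ((σOfRecord F ν M p g k s t).Λ (k + 1))ᶜ) :
    ∃ c ∈ Zreg F ν M p g k s ∪ (cubesχ F ν p g k t.1 ∪ (cubesχ F ν p g k t.2.1 ∪ cubesχ F ν p g k t.2.2.1)),
      ∀ i, coordDist c x i + 1 ≤ 25 * sideD F ν M p g k :=
  exists_near_of_mem_hullD (compl_Λ_succ_σOfRecord_subset_hullD hsD s t hx)

/-- **FAR FROM THE OLD REGION, THE NEAR POINT IS IN A LABEL CUBE**: if every point of `Z_k` is farther than `25·sideD k − 1` from `x` in some coordinate, the near point of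
`exists_near_of_mem_compl_Λ_succ_σOfRecord` lies in `∪P ∪ ∪Q ∪ ∪R` — the «fresh exit» at `x` is witnessed by a NEW large-field cube of the label.
[cite: Balaban1988Convergent, (3.5) p.265, (3.20) p.269 (bookkeeping); Balaban1989LargeFieldII, (1.79) p.383 (the new-region factor)] -/
theorem exists_near_label_of_mem_compl_Λ_succ_σOfRecord_of_far (hsD : 0 < sideD F ν M p g k) (s : SeqOfRecord F ν M g p.K k) (t : LbOfRecord F ν p g k)
    {x : Site (F.P p.K) 0} (hx : x ∈ ((σOfRecord F ν M p g k s t).Λ (k + 1))ᶜ)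
    (hfar : ∀ z ∈ Zreg F ν M p g k s, ∃ i, 25 * sideD F ν M p g k ≤ coordDist z x i) :
    ∃ c ∈ cubesχ F ν p g k t.1 ∪ (cubesχ F ν p g k t.2.1 ∪ cubesχ F ν p g k t.2.2.1), ∀ i, coordDist c x i + 1 ≤ 25 * sideD F ν M p g k := by
  obtain ⟨c, hc, hnear⟩ := exists_near_of_mem_compl_Λ_succ_σOfRecord hsD s t hx
  rcases hc with hcZ | hcL
  · obtain ⟨i, hi⟩ := hfar c hcZ
    have := hnear i
    omega
  · exact ⟨c, hcL, hnear⟩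

end IndexMap

/-! ## §3  Down a PRESENT history: every point of `Z_k` is near a label cube of SOME level, within the sum of the per-level radii -/

section History

variable {F : T4Family} {ν : Stage7Numerics} {M : ℕ} {p : B12.RunParams} {g : ℕ → ℝ}

open scoped BigOperators in
/-- ★★★ **THE TRACE-BACK OF A LARGE-FIELD POINT TO A LABEL CUBE, DOWN A PRESENT HISTORY.**  Let `s` be a length-`k` sequence of record every level of which is PRODUCED by
def-T's index map from the level below (`∀ j < k, ∃ t, σOfRecord … j (s↾j) t = s↾(j+1)` — true of every sequence with a non-zero slot of record, dag-n11-e's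
`exists_label_of_slotsOfRecord_succ_ne_zero` iterated), all cube sides positive.  Then every point `x` of its last large-field region `Z_k = Zreg s` (`= Λ_kᶜ`, `k ≥ 1`) has a
level `j < k`, a label `t` producing `s↾(j+1)` from `s↾j`, and a point `c` of a label cube of `t` (`∪P_t ∪ ∪Q_t ∪ ∪R_t`, χ_{j+1}-cubes) with
`coordDist c x i + 1 ≤ Σ_{l ∈ [j, k)} 25·sideD l` in every coordinate — by induction on `k`: the one-step collar radius (§2), then either a label cube at the top step or the
old region `Z_{k−1} = Zreg (s↾(k−1))` and the induction hypothesis, glued by the triangle inequality.  (In print's regime `sideD (l+1) ≥ 2·sideD l` the sum is `≤ 50·sideD (k−1)`: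
[LF-II] (1.76) ∕ (1.84)-type control of a component by its generating large-field cubes.) [cite: Balaban1988Convergent, (3.5) p.265, (3.20) p.269 (bookkeeping); Balaban1989LargeFieldII, (1.80)–(1.81) p.384–385] -/
theorem exists_label_near_of_mem_Zreg_of_present (hsD : ∀ l, 0 < sideD F ν M p g l) :
    ∀ (k : ℕ) (s : SeqOfRecord F ν M g p.K k),
      (∀ j (hj : j < k), ∃ t : LbOfRecord F ν p g j, σOfRecord F ν M p g j (s.restrict (Nat.le_of_lt hj)) t = s.restrict (Nat.succ_le_of_lt hj)) →
      ∀ x ∈ Zreg F ν M p g k s, ∃ (j : ℕ) (hj : j < k) (t : LbOfRecord F ν p g j),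
        σOfRecord F ν M p g j (s.restrict (Nat.le_of_lt hj)) t = s.restrict (Nat.succ_le_of_lt hj) ∧
        ∃ c ∈ cubesχ F ν p g j t.1 ∪ (cubesχ F ν p g j t.2.1 ∪ cubesχ F ν p g j t.2.2.1),
          ∀ i, coordDist c x i + 1 ≤ ∑ l ∈ Finset.Ico j k, 25 * sideD F ν M p g l := by
  intro k
  induction k with
  | zero =>
    intro s _ x hx
    simp [Zreg] at hx
  | succ k ih =>
    intro s hpres x hx
    -- the top step: `s = σ (s↾k) t`
    obtain ⟨t, ht⟩ := hpres k (Nat.lt_succ_self k)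
    have hs : s.restrict (Nat.succ_le_of_lt (Nat.lt_succ_self k)) = s := Seq.restrict_self s
    have hxZ : x ∈ ((σOfRecord F ν M p g k (s.restrict (Nat.le_of_lt (Nat.lt_succ_self k))) t).Λ (k + 1))ᶜ := by
      rw [ht, hs]
      simpa [Zreg] using hx
    obtain ⟨c, hc, hnear⟩ := exists_near_of_mem_compl_Λ_succ_σOfRecord (hsD k) _ t hxZ
    rcases hc with hcZ | hcL
    · -- `c` lies in the old region `Z_k` of the prefix: induction hypothesis for `s↾k`, then the triangle inequality
      have hpres' : ∀ j (hj : j < k), ∃ t' : LbOfRecord F ν p g j,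
          σOfRecord F ν M p g j ((s.restrict (Nat.le_of_lt (Nat.lt_succ_self k))).restrict (Nat.le_of_lt hj)) t' =
            (s.restrict (Nat.le_of_lt (Nat.lt_succ_self k))).restrict (Nat.succ_le_of_lt hj) := by
        intro j hj
        obtain ⟨t', ht'⟩ := hpres j (Nat.lt_succ_of_lt hj)
        refine ⟨t', ?_⟩
        rw [Seq.restrict_restrict, Seq.restrict_restrict]
        exact ht'
      obtain ⟨j, hj, t', ht', c', hc', hnear'⟩ := ih _ hpres' c hcZ
      refine ⟨j, Nat.lt_succ_of_lt hj, t', ?_, c', hc', fun i => ?_⟩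
      · rw [Seq.restrict_restrict, Seq.restrict_restrict] at ht'
        exact ht'
      · rw [Finset.sum_Ico_succ_top (Nat.le_of_lt hj)]
        have h1 := hnear' i
        have h2 := hnear i
        have h3 := coordDist_triangle c' c x i
        omega
    · -- `c` lies in a label cube of the top step
      refine ⟨k, Nat.lt_succ_self k, t, ht, c, hcL, fun i => ?_⟩
      rw [Finset.sum_Ico_succ_top le_rfl, Finset.Ico_self, Finset.sum_empty, zero_add]
      exact hnear i

end History

/-! ## §4  PRESENT histories: every sequence with a non-zero slot of a start-generic tower (F3's dressed slots) is produced level by level by the index map -/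

section Present

variable (F : T4Family) (N : ℕ) [NeZero N] (ν : Stage7Numerics) (τ : TowerNumerics)
  (start : (p : B12.RunParams) → (ℕ → ℝ) → Density (F.P p.K) 0 (SU N)) (A₁ : ℝ) (ζ : ZetaOfRecord F N ν τ.M) (ppSel : PpSelOfRecord F ν τ.M)
  (p : B12.RunParams) (g : ℕ → ℝ)

/-- **AN ABSENT PARENT HAS ABSENT CHILDREN** in F3's start-generic tower (any start, any selector): `slot_k(init s′) = 0 ⇒ slot_{k+1}(s′) = 0` (the 𝐓-step transports
`w·χ_k·slot_k(init s′) ≡ 0`, def-R's 𝐑-step keeps a zero slot zero — dag-n11-e's `B14SeparationOfRecord` §3 for the undressed tower, verbatim one start up).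
[cite: Balaban1988Convergent, (3.1) p.264, (3.24)–(3.25) p.270; Balaban1989LargeFieldI, (0.3) p.176] -/
theorem texpAOfRecordFrom_succ_eq_zero_of_init_eq_zero (k : ℕ) (s' : SeqOfRecord F ν τ.M g p.K (k + 1))
    (h0 : texpAOfRecordFrom F N ν τ.M start (wOfRecord F N ν τ.M A₁ ζ) (rstepSlotOfRecord F N ν τ ppSel) p g k s'.init = 0) :
    texpAOfRecordFrom F N ν τ.M start (wOfRecord F N ν τ.M A₁ ζ) (rstepSlotOfRecord F N ν τ ppSel) p g (k + 1) s' = 0 := by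
  funext V
  rw [texpAOfRecordFrom_succ, Pi.zero_apply]
  apply B16RLeafRecord12.rstepSlotOfRecord_eq_zero_of_eq_zero
  funext V'
  rw [tstepOfRecord_apply, Pi.zero_apply]
  apply B14SeparationOfRecord.transportOfRecord_eq_zero_of_forall
  intro U
  rw [h0, Pi.zero_apply, mul_zero, mul_zero]

/-- **A SEQUENCE NOT PRODUCED BY THE INDEX MAP HAS THE ZERO SLOT** in the start-generic tower (any start, any selector; the resummed weight of an absent sequence is `0`).
[cite: Balaban1988Convergent, (3.5) p.265, (3.20) p.269, (3.24)–(3.25) p.270; Balaban1989LargeFieldI, (0.3) p.176] -/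
theorem texpAOfRecordFrom_succ_eq_zero_of_forall_σ_ne (k : ℕ) (s' : SeqOfRecord F ν τ.M g p.K (k + 1))
    (h : ∀ t, σOfRecord F ν τ.M p g k s'.init t ≠ s') :
    texpAOfRecordFrom F N ν τ.M start (wOfRecord F N ν τ.M A₁ ζ) (rstepSlotOfRecord F N ν τ ppSel) p g (k + 1) s' = 0 := by
  funext V
  rw [texpAOfRecordFrom_succ, Pi.zero_apply]
  apply B16RLeafRecord12.rstepSlotOfRecord_eq_zero_of_eq_zero
  funext V'
  rw [tstepOfRecord_apply, Pi.zero_apply]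
  apply B14SeparationOfRecord.transportOfRecord_eq_zero_of_forall
  intro U
  rw [B14SeparationOfRecord.wOfRecord_eq_zero_of_forall_σ_ne F N ν τ p g k A₁ ζ s' h, zero_mul]

/-- ★★ **EVERY SEQUENCE WITH A NON-ZERO SLOT IS PRESENT AT EVERY LEVEL**: if `slot_k(s) ≠ 0` in the start-generic tower, then every level of `s` is produced by the index map from the
one below — the hypothesis of `exists_label_near_of_mem_Zreg_of_present` (induction over the history). [cite: Balaban1988Convergent, (3.5) p.265, (3.20) p.269, (3.24)–(3.25) p.270; Balaban1989LargeFieldI, (0.3) p.176] -/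
theorem present_of_texpAOfRecordFrom_ne_zero : ∀ (k : ℕ) (s : SeqOfRecord F ν τ.M g p.K k),
    texpAOfRecordFrom F N ν τ.M start (wOfRecord F N ν τ.M A₁ ζ) (rstepSlotOfRecord F N ν τ ppSel) p g k s ≠ 0 →
    ∀ j (hj : j < k), ∃ t : LbOfRecord F ν p g j, σOfRecord F ν τ.M p g j (s.restrict (Nat.le_of_lt hj)) t = s.restrict (Nat.succ_le_of_lt hj) := by
  intro k
  induction k with
  | zero => intro s _ j hj; exact absurd hj (Nat.not_lt_zero j)
  | succ k ih =>
    intro s hs j hj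
    have hinit : texpAOfRecordFrom F N ν τ.M start (wOfRecord F N ν τ.M A₁ ζ) (rstepSlotOfRecord F N ν τ ppSel) p g k s.init ≠ 0 :=
      fun h0 => hs (texpAOfRecordFrom_succ_eq_zero_of_init_eq_zero F N ν τ start A₁ ζ ppSel p g k s h0)
    rcases Nat.lt_succ_iff_lt_or_eq.1 hj with hlt | rfl
    · obtain ⟨t, ht⟩ := ih s.init hinit j hlt
      refine ⟨t, ?_⟩
      rw [Seq.init_eq_restrict, Seq.restrict_restrict, Seq.restrict_restrict] at ht
      exact ht
    · have hex : ∃ t, σOfRecord F ν τ.M p g j s.init t = s := by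
        by_contra hne
        exact hs (texpAOfRecordFrom_succ_eq_zero_of_forall_σ_ne F N ν τ start A₁ ζ ppSel p g j s fun t ht => hne ⟨t, ht⟩)
      obtain ⟨t, ht⟩ := hex
      refine ⟨t, ?_⟩
      rw [Seq.init_eq_restrict] at ht
      rw [Seq.restrict_self]
      exact ht

/-- ★★ **F3's DRESSED SLOTS: a sequence with a non-zero dressed slot at some level is present at every level** (the dressed family IS the start-generic tower at the dressed start,
`rfl`). [cite: Balaban1988Convergent, (2.18) p.257, (3.24)–(3.25) p.270 (bookkeeping)] -/
theorem present_of_dressedSlotsOfDatum₉_ne_zero (ϑ : Stage9Params F N) (D : FiniteEpsData F (SU N)) (g₀ : ℕ → ℝ) (os : List (ULoop F)) (t : ℝ)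
    (p : B12.RunParams) (g : ℕ → ℝ) (k : ℕ) (s : SeqOfRecord F ϑ.ν ϑ.τ9.M g p.K k) (hs : dressedSlotsOfDatum₉ F N ϑ D g₀ os t p g k s ≠ 0) :
    ∀ j (hj : j < k), ∃ lb : LbOfRecord F ϑ.ν p g j, σOfRecord F ϑ.ν ϑ.τ9.M p g j (s.restrict (Nat.le_of_lt hj)) lb = s.restrict (Nat.succ_le_of_lt hj) :=
  present_of_texpAOfRecordFrom_ne_zero F N ϑ.ν ϑ.τ9 _ ϑ.A₁ ϑ.ζ ϑ.ppSel p g k s hs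

open scoped BigOperators in
/-- ★★★ **THE GEOMETRIC LETTER OF THE N20 LINEAGE**: for F3's dressed tower at ANY Stage-9 tuple (any selector), a sequence `s` with a NON-ZERO dressed slot at level `k` and a point
`x` of its large-field region `Z_k = Zreg s`: some level `j < k`, some label `t` producing `s↾(j+1)` from `s↾j`, and some point `c` of a label cube of `t` have
`coordDist c x i + 1 ≤ Σ_{l∈[j,k)} 25·sideD l` for every coordinate (all cube sides positive).  What a label-currency count of large-field components books against: every large-field
point is generated, within the summed collar radius, by a NEW large-field cube of its own history. [cite: Balaban1988Convergent, (3.5) p.265, (3.20) p.269; Balaban1989LargeFieldII, (1.79) p.383, (1.80)–(1.81) p.384–385] -/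
theorem exists_label_near_of_mem_Zreg_of_dressedSlotsOfDatum₉_ne_zero (ϑ : Stage9Params F N) (D : FiniteEpsData F (SU N)) (g₀ : ℕ → ℝ)
    (os : List (ULoop F)) (t : ℝ) (p : B12.RunParams) (g : ℕ → ℝ) (hsD : ∀ l, 0 < sideD F ϑ.ν ϑ.τ9.M p g l) (k : ℕ) (s : SeqOfRecord F ϑ.ν ϑ.τ9.M g p.K k)
    (hs : dressedSlotsOfDatum₉ F N ϑ D g₀ os t p g k s ≠ 0) (x : Site (F.P p.K) 0) (hx : x ∈ Zreg F ϑ.ν ϑ.τ9.M p g k s) :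
    ∃ (j : ℕ) (hj : j < k) (lb : LbOfRecord F ϑ.ν p g j),
      σOfRecord F ϑ.ν ϑ.τ9.M p g j (s.restrict (Nat.le_of_lt hj)) lb = s.restrict (Nat.succ_le_of_lt hj) ∧
      ∃ c ∈ cubesχ F ϑ.ν p g j lb.1 ∪ (cubesχ F ϑ.ν p g j lb.2.1 ∪ cubesχ F ϑ.ν p g j lb.2.2.1),
        ∀ i, coordDist c x i + 1 ≤ ∑ l ∈ Finset.Ico j k, 25 * sideD F ϑ.ν ϑ.τ9.M p g l :=
  exists_label_near_of_mem_Zreg_of_present hsD k s (present_of_dressedSlotsOfDatum₉_ne_zero F N ϑ D g₀ os t p g k s hs) x hx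

end Present

end Literature.MathematicalPhysics.QuantumFieldTheory.Balaban1983to89.Node00

end
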